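import Literature.NumberTheory.GaloisRepresentations.PadicAlgClFiniteSubextensionDvr
import Literature.AlgebraicGeometry.Resolution.CompleteFiniteness
import Literature.AlgebraicGeometry.Resolution.FormalFibres
import Literature.AlgebraicGeometry.Resolution.CohenStructure
import Literature.AlgebraicGeometry.Motives.CurveThroughPoint
import Mathlib.RingTheory.DiscreteValuationRing.Basic
import Mathlib.FieldTheory.IsAlgClosed.Basic
import Mathlib.RingTheory.Localization.FractionRing
import Mathlib.RingTheory.Polynomial.Tower
import HarnessLib

/-!
# `ℚ̄_p`-valued points separate the elements of a `p`-torsion-free complete Noetherian local ring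

Topic `Literature/NumberTheory/GaloisRepresentations`; theorems only (no definition, no named fact).
Let `𝒪` be a discrete valuation ring, complete, embedded in `ℚ̄_p = PadicAlgCl p` by `ι` with
`‖ι(x)‖ ≤ 1` (intended: `𝒪 = 𝒪_E`, `E/ℚ_p` finite), and let `T` be a complete Noetherian local
`𝒪`-algebra with the SAME residue field (`𝒪 → T → T/𝔪_T` onto, `𝔪_𝒪 T ⊆ 𝔪_T`).

* `norm_le_one_of_eval₂_eq_zero` — a root in `ℚ̄_p` of a monic polynomial with coefficients in
  `ι(𝒪)` lies in the closed unit ball (integral over the integral closure of `ℤ_p`);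
* `exists_ringHom_padicAlgCl_injective_of_module_finite` — if `T` is a domain finite over `𝒪`, it
  embeds `𝒪`-linearly into `ℚ̄_p` with image in the closed unit ball (fraction fields + the
  algebraic closedness of `ℚ̄_p`);
* `module_finite_of_height_le_one` — if `T` is a domain with `dim T ≤ 1` and `𝒪 → T` injective,
  then `T` is finite over `𝒪` (`𝔪_𝒪 T` is `𝔪_T`-primary; Matsumura Thm. 8.4 via the tree's
  `module_finite_of_isAdicComplete_of_residue_surjective`);
* `exists_ringHom_padicAlgCl_apply_ne_zero_of_isDomain` — if `T` is a domain and `𝒪 → T` is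
  injective, every `f ≠ 0` survives in some `𝒪`-point `ψ : T → ℚ̄_p`, `‖ψ‖ ≤ 1`, `ψ f ≠ 0`
  (induction on the dimension: cut by a height-one prime avoiding `f` and `ϖ`, the tree's
  `exists_isPrime_height_eq_one_le_not_le`);
* **`exists_ringHom_padicAlgCl_apply_ne_zero`** — if the uniformiser of `𝒪` is a non-zero-divisor
  of `T` (`T` is `𝒪`-flat), every non-nilpotent `f ∈ T` survives in some `𝒪`-point
  `ψ : T → ℚ̄_p` with `‖ψ‖ ≤ 1`: the `𝒪_{ℚ̄_p}`-valued points of `Spec T` are ZARISKI-DENSE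
  (`⋂ ker ψ = nilradical`).  This is the algebraic input that turns "the big Hecke algebra is
  `p`-torsion-free of Krull dimension `d`" into "its characteristic-`0` eigensystems are
  Zariski-dense in a `d`-dimensional closed subscheme of the deformation space" in big `R = 𝕋`
  arguments (Gouvêa–Mazur, Böckle, Gee–Newton);
* `eq_zero_of_forall_ringHom_padicAlgCl_apply_eq_zero` — the separation form for `T` reduced.

References: H. Matsumura, *Commutative Ring Theory* (1986), Thm. 8.4 and proof of Thm. 29.4;
A. J. de Jong, *Crystalline Dieudonné module theory via formal and rigid geometry*, Publ. IHÉS 82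
(1995), §7.1 (points of `𝒪`-flat formal schemes); folklore.
-/

noncomputable section

open IsLocalRing Polynomial

namespace Literature.NumberTheory.GaloisRepresentations

universe u v

variable {p : ℕ} [Fact p.Prime]

/-! ### Integrality and the unit ball -/

/-- A root in `ℚ̄_p` of a monic polynomial whose coefficients are images of a ring `𝒪` mapping
into the closed unit ball is itself in the closed unit ball: it is integral over the integral
closure of `ℤ_p` in `ℚ̄_p`, hence over `ℤ_p` (the unit ball, `PadicAlgCl.norm_le_one_iff_isIntegral`).
[folklore] -/
theorem norm_le_one_of_eval₂_eq_zero {𝒪 : Type v} [CommRing 𝒪] (ι : 𝒪 →+* PadicAlgCl p)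
    (hιn : ∀ x, ‖ι x‖ ≤ 1) {P : 𝒪[X]} (hP : P.Monic) {y : PadicAlgCl p}
    (hy : P.eval₂ ι y = 0) : ‖y‖ ≤ 1 := by
  let A := integralClosure ℤ_[p] (PadicAlgCl p)
  have hιA : ∀ x, ι x ∈ A := fun x => (PadicAlgCl.norm_le_one_iff_isIntegral (ι x)).mp (hιn x)
  -- `P.map ι` has coefficients in `A`, hence lifts to a monic polynomial over `A`
  have hlifts : P.map ι ∈ Polynomial.lifts (algebraMap A (PadicAlgCl p)) := by
    refine (Polynomial.lifts_iff_coeff_lifts _).mpr fun n => ?_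
    rw [Polynomial.coeff_map]
    exact ⟨⟨ι (P.coeff n), hιA _⟩, rfl⟩
  obtain ⟨Q, hQmap, -, hQmonic⟩ :=
    Polynomial.lifts_and_degree_eq_and_monic hlifts (hP.map ι)
  have hyA : IsIntegral A y := by
    refine ⟨Q, hQmonic, ?_⟩
    rw [Polynomial.eval₂_eq_eval_map, hQmap, Polynomial.eval_map, hy]
  rw [PadicAlgCl.norm_le_one_iff_isIntegral]
  exact isIntegral_trans y hyA

variable {𝒪 : Type v} [CommRing 𝒪] [IsDomain 𝒪] [IsDiscreteValuationRing 𝒪]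
variable (ι : 𝒪 →+* PadicAlgCl p)

/-! ### Finite domains over `𝒪` embed into `ℚ̄_p` -/

/-- **A domain finite over `𝒪` embeds `𝒪`-linearly into `ℚ̄_p`, inside the closed unit ball.**
With `E₀ = Frac 𝒪 ↪ ℚ̄_p` induced by `ι` and `L = Frac T` algebraic over `E₀`, the algebraic
closedness of `ℚ̄_p` extends the embedding to `L`; every `x ∈ T` is integral over `𝒪`, so `ψ(x)` is
a root of a monic polynomial with coefficients in `ι(𝒪)`, hence `‖ψ(x)‖ ≤ 1`. [folklore] -/
theorem exists_ringHom_padicAlgCl_injective_of_module_finite (hι : Function.Injective ι)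
    (hιn : ∀ x, ‖ι x‖ ≤ 1) (T : Type u) [CommRing T] [IsDomain T] [Algebra 𝒪 T]
    [Module.Finite 𝒪 T] (hinj : Function.Injective (algebraMap 𝒪 T)) :
    ∃ ψ : T →+* PadicAlgCl p, ψ.comp (algebraMap 𝒪 T) = ι ∧ (∀ x, ‖ψ x‖ ≤ 1) ∧
      Function.Injective ψ := by
  let E₀ := FractionRing 𝒪
  let L := FractionRing T
  have hinjL : Function.Injective (algebraMap 𝒪 L) := by
    rw [IsScalarTower.algebraMap_eq 𝒪 T L]
    exact (IsFractionRing.injective T L).comp hinj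
  haveI : FaithfulSMul 𝒪 L := (faithfulSMul_iff_algebraMap_injective 𝒪 L).mpr hinjL
  haveI : Module.IsTorsionFree 𝒪 L := Module.isTorsionFree_iff_algebraMap_injective.mpr hinjL
  letI : Algebra E₀ L := FractionRing.liftAlgebra 𝒪 L
  haveI : IsScalarTower 𝒪 E₀ L := FractionRing.isScalarTower_liftAlgebra 𝒪 L
  -- `L / E₀` is algebraic (`T / 𝒪` is integral)
  haveI : Algebra.IsIntegral 𝒪 T := Algebra.IsIntegral.of_finite 𝒪 T
  haveI : Algebra.IsAlgebraic 𝒪 L :=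
    (IsFractionRing.isAlgebraic_iff' 𝒪 T L).mp inferInstance
  haveI : Algebra.IsAlgebraic E₀ L :=
    Algebra.IsAlgebraic.extendScalars (R := 𝒪) (S := E₀) (A := L)
      (IsFractionRing.injective 𝒪 E₀)
  -- `E₀ ↪ ℚ̄_p`
  let j : E₀ →+* PadicAlgCl p := IsFractionRing.lift hι
  letI : Algebra E₀ (PadicAlgCl p) := j.toAlgebra
  let Ψ : L →ₐ[E₀] PadicAlgCl p := IsAlgClosed.lift
  let ψ : T →+* PadicAlgCl p := (Ψ : L →+* PadicAlgCl p).comp (algebraMap T L)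
  have hcomp : ψ.comp (algebraMap 𝒪 T) = ι := by
    ext x
    change Ψ (algebraMap T L (algebraMap 𝒪 T x)) = ι x
    rw [← IsScalarTower.algebraMap_apply, IsScalarTower.algebraMap_apply 𝒪 E₀ L, AlgHom.commutes]
    exact IsFractionRing.lift_algebraMap hι x
  refine ⟨ψ, hcomp, fun x => ?_, ?_⟩
  · obtain ⟨P, hPmonic, hPx⟩ := Algebra.IsIntegral.isIntegral (R := 𝒪) x
    refine norm_le_one_of_eval₂_eq_zero ι hιn hPmonic (y := ψ x) ?_
    have := congrArg ψ hPx
    rwa [Polynomial.hom_eval₂, hcomp, map_zero] at this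
  · exact (Ψ : L →+* PadicAlgCl p).injective.comp (IsFractionRing.injective T L)

/-! ### Dimension `≤ 1`: finiteness over `𝒪` -/

variable [IsAdicComplete (maximalIdeal 𝒪) 𝒪]

/-- **A complete Noetherian local domain of dimension `≤ 1` with residue field that of `𝒪` is
finite over `𝒪`.**  If `𝒪 → T` is injective and local with `T/𝔪_T = 𝒪/𝔪_𝒪` and
`ht 𝔪_T ≤ 1`, then `𝔪_T` is the only prime over `𝔪_𝒪 T ≠ 0`, so `𝔪_T^N ⊆ 𝔪_𝒪 T`, and
Matsumura's Thm. 8.4 (`module_finite_of_isAdicComplete_of_residue_surjective`) applies.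
[cite: Matsumura1987, Thm. 8.4 and proof of Thm. 29.4 (iii)] -/
theorem module_finite_of_height_le_one (T : Type u) [CommRing T] [IsDomain T] [IsLocalRing T]
    [IsNoetherianRing T] [IsAdicComplete (maximalIdeal T) T] [Algebra 𝒪 T]
    (hinj : Function.Injective (algebraMap 𝒪 T))
    (hloc : (maximalIdeal 𝒪).map (algebraMap 𝒪 T) ≤ maximalIdeal T)
    (hres : Function.Surjective ((residue T).comp (algebraMap 𝒪 T)))
    (hdim : (maximalIdeal T).height ≤ 1) : Module.Finite 𝒪 T := by
  have hne : (maximalIdeal 𝒪).map (algebraMap 𝒪 T) ≠ ⊥ := by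
    intro h
    have hm : maximalIdeal 𝒪 ≠ ⊥ := by
      intro hbot
      exact IsDiscreteValuationRing.not_isField 𝒪 ((IsLocalRing.isField_iff_maximalIdeal_eq).mpr hbot)
    obtain ⟨x, hx, hx0⟩ := Submodule.exists_mem_ne_zero_of_ne_bot hm
    have : algebraMap 𝒪 T x = 0 := by
      rw [← Ideal.mem_bot, ← h]
      exact Ideal.mem_map_of_mem _ hx
    exact hx0 (hinj (by rw [this, map_zero]))
  -- `𝔪_T` is minimal over `𝔪_𝒪 T`
  have hmin : maximalIdeal T ∈ ((maximalIdeal 𝒪).map (algebraMap 𝒪 T)).minimalPrimes := by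
    refine ⟨⟨inferInstance, hloc⟩, fun P ⟨hP, hPJ⟩ hPm => ?_⟩
    -- `P ≠ ⊥` is a prime below `𝔪_T`, of height `≥ 1`; `ht 𝔪_T ≤ 1` forces `P = 𝔪_T`
    by_contra hcontra
    have hlt : P < maximalIdeal T := lt_of_le_of_ne hPm fun h => hcontra (h ▸ le_rfl)
    have hP0 : P ≠ ⊥ := fun h => hne (le_bot_iff.mp (h ▸ hPJ))
    haveI := hP
    have h1 : (⊥ : Ideal T) < P := bot_lt_iff_ne_bot.mpr hP0
    have hh1 : (⊥ : Ideal T).height < P.height :=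
      Ideal.height_strict_mono_of_isPrime_of_isPrime h1
    have hh2 : P.height < (maximalIdeal T).height :=
      Ideal.height_strict_mono_of_isPrime_of_isPrime hlt
    have hP1 : (1 : ℕ∞) ≤ P.height := by
      have := Order.add_one_le_of_lt hh1
      rwa [Ideal.height_bot, zero_add] at this
    have h2 : (2 : ℕ∞) ≤ (maximalIdeal T).height :=
      calc (2 : ℕ∞) = 1 + 1 := by norm_num
        _ ≤ P.height + 1 := add_le_add_left hP1 1
        _ ≤ (maximalIdeal T).height := Order.add_one_le_of_lt hh2
    have h21 : (2 : ℕ∞) ≤ 1 := h2.trans hdim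
    exact absurd h21 (by decide)
  obtain ⟨N, hN⟩ :=
    Literature.AlgebraicGeometry.Resolution.exists_maximalIdeal_pow_le_of_mem_minimalPrimes hmin
  exact Literature.AlgebraicGeometry.Resolution.module_finite_of_isAdicComplete_of_residue_surjective
    hloc hres ⟨N, hN⟩


/-! ### Quotients by primes avoiding the uniformiser -/

omit [IsAdicComplete (maximalIdeal 𝒪) 𝒪] in
/-- If a prime `𝔮` of an `𝒪`-algebra `T` contains no image of a non-zero element of the discrete
valuation ring `𝒪` — equivalently, misses the image of a uniformiser — then `𝒪 → T/𝔮` is injective.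
[folklore] -/
theorem injective_algebraMap_quotient_of_notMem {T : Type u} [CommRing T] [Algebra 𝒪 T]
    {ϖ : 𝒪} (hϖ : Irreducible ϖ) (𝔮 : Ideal T) [𝔮.IsPrime] (hϖ𝔮 : algebraMap 𝒪 T ϖ ∉ 𝔮) :
    Function.Injective (algebraMap 𝒪 (T ⧸ 𝔮)) := by
  rw [injective_iff_map_eq_zero]
  intro x hx
  rw [IsScalarTower.algebraMap_apply 𝒪 T (T ⧸ 𝔮), Ideal.Quotient.algebraMap_eq,
    Ideal.Quotient.eq_zero_iff_mem] at hx
  by_contra hx0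
  obtain ⟨k, u, rfl⟩ := IsDiscreteValuationRing.eq_unit_mul_pow_irreducible hx0 hϖ
  rw [map_mul, map_pow] at hx
  rcases (‹𝔮.IsPrime›.mem_or_mem hx) with hu | hpow
  · exact ‹𝔮.IsPrime›.ne_top (Ideal.eq_top_of_isUnit_mem _ hu ((Units.isUnit u).map _))
  · exact hϖ𝔮 (‹𝔮.IsPrime›.mem_of_pow_mem k hpow)

omit [IsDomain 𝒪] [IsDiscreteValuationRing 𝒪] [IsAdicComplete (maximalIdeal 𝒪) 𝒪] in
/-- Residue-field surjectivity `𝒪 ↠ T/𝔪_T` passes to quotients of `T`. [folklore] -/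
theorem surjective_residue_comp_algebraMap_quotient {T : Type u} [CommRing T] [IsLocalRing T]
    [Algebra 𝒪 T] (hres : Function.Surjective ((residue T).comp (algebraMap 𝒪 T)))
    (𝔮 : Ideal T) [IsLocalRing (T ⧸ 𝔮)] :
    Function.Surjective ((residue (T ⧸ 𝔮)).comp (algebraMap 𝒪 (T ⧸ 𝔮))) := by
  intro y
  obtain ⟨t', rfl⟩ := IsLocalRing.residue_surjective y
  obtain ⟨t, rfl⟩ := Ideal.Quotient.mk_surjective t'
  obtain ⟨a, ha⟩ := hres (residue T t)
  refine ⟨a, ?_⟩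
  rw [RingHom.comp_apply] at ha ⊢
  rw [IsScalarTower.algebraMap_apply 𝒪 T (T ⧸ 𝔮), Ideal.Quotient.algebraMap_eq]
  have hsub : algebraMap 𝒪 T a - t ∈ maximalIdeal T := by
    rw [← Ideal.Quotient.eq]
    exact ha
  have hmap : (maximalIdeal T).map (Ideal.Quotient.mk 𝔮) = maximalIdeal (T ⧸ 𝔮) :=
    IsLocalRing.map_maximalIdeal_of_surjective _ Ideal.Quotient.mk_surjective
  have hsub' : Ideal.Quotient.mk 𝔮 (algebraMap 𝒪 T a) - Ideal.Quotient.mk 𝔮 t ∈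
      maximalIdeal (T ⧸ 𝔮) := by
    rw [← map_sub, ← hmap]
    exact Ideal.mem_map_of_mem _ hsub
  exact (Ideal.Quotient.eq).mpr hsub'


/-! ### Domains: `𝒪`-points separating a non-zero element -/

/-- **In a complete Noetherian local domain `T` over `𝒪` (same residue field, `𝒪 → T`
injective), every `f ≠ 0` survives in some `𝒪`-point `T → ℚ̄_p` of norm `≤ 1`.**  Induction on
`ht 𝔪_T`: if `ht 𝔪_T ≤ 1`, `T` is finite over `𝒪` and embeds; otherwise there is a height-one
prime `𝔮 ∌ f·ϖ` (prime avoidance + Krull, `exists_isPrime_height_eq_one_le_not_le`) and one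
recurses on `T/𝔮`, still a complete local domain into which `𝒪` injects, of smaller dimension.
[folklore] -/
theorem exists_ringHom_padicAlgCl_apply_ne_zero_of_isDomain (hι : Function.Injective ι)
    (hιn : ∀ x, ‖ι x‖ ≤ 1) (n : ℕ) :
    ∀ (T : Type u) [CommRing T] [IsLocalRing T] [IsNoetherianRing T]
      [IsAdicComplete (maximalIdeal T) T] [Algebra 𝒪 T], IsDomain T →
      Function.Injective (algebraMap 𝒪 T) →
      (maximalIdeal 𝒪).map (algebraMap 𝒪 T) ≤ maximalIdeal T →
      Function.Surjective ((residue T).comp (algebraMap 𝒪 T)) →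
      (maximalIdeal T).height ≤ n →
      ∀ f : T, f ≠ 0 →
        ∃ ψ : T →+* PadicAlgCl p, ψ.comp (algebraMap 𝒪 T) = ι ∧ (∀ x, ‖ψ x‖ ≤ 1) ∧ ψ f ≠ 0 := by
  -- the case of dimension `≤ 1`, used twice
  have base : ∀ (T : Type u) [CommRing T] [IsLocalRing T] [IsNoetherianRing T]
      [IsAdicComplete (maximalIdeal T) T] [Algebra 𝒪 T], IsDomain T →
      Function.Injective (algebraMap 𝒪 T) →
      (maximalIdeal 𝒪).map (algebraMap 𝒪 T) ≤ maximalIdeal T →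
      Function.Surjective ((residue T).comp (algebraMap 𝒪 T)) →
      (maximalIdeal T).height ≤ 1 →
      ∀ f : T, f ≠ 0 →
        ∃ ψ : T →+* PadicAlgCl p, ψ.comp (algebraMap 𝒪 T) = ι ∧ (∀ x, ‖ψ x‖ ≤ 1) ∧ ψ f ≠ 0 := by
    intro T _ _ _ _ _ hdom hinj hloc hres hdim f hf
    haveI := hdom
    haveI : Module.Finite 𝒪 T := module_finite_of_height_le_one T hinj hloc hres hdim
    obtain ⟨ψ, hψ, hψn, hψinj⟩ :=
      exists_ringHom_padicAlgCl_injective_of_module_finite ι hι hιn T hinj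
    exact ⟨ψ, hψ, hψn, fun h => hf (hψinj (by rw [h, map_zero]))⟩
  induction n with
  | zero =>
    intro T _ _ _ _ _ hdom hinj hloc hres hdim f hf
    exact base T hdom hinj hloc hres (hdim.trans (by norm_num)) f hf
  | succ n ih =>
    intro T _ _ _ _ _ hdom hinj hloc hres hdim f hf
    haveI := hdom
    by_cases h1 : (maximalIdeal T).height ≤ 1
    · exact base T hdom hinj hloc hres h1 f hf
    -- dimension `≥ 2`: cut by a height-one prime avoiding `f` and the uniformiser
    have h2 : 2 ≤ (maximalIdeal T).height := by
      rw [not_le] at h1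
      have := Order.add_one_le_of_lt h1
      exact le_of_eq_of_le (by norm_num) this
    obtain ⟨ϖ, hϖ⟩ := IsDiscreteValuationRing.exists_irreducible 𝒪
    have hϖ0 : algebraMap 𝒪 T ϖ ≠ 0 := fun h => hϖ.ne_zero (hinj (by rw [h, map_zero]))
    have hI : Ideal.span {f * algebraMap 𝒪 T ϖ} ≠ ⊥ := by
      rw [Ne, Ideal.span_singleton_eq_bot]
      exact mul_ne_zero hf hϖ0
    obtain ⟨𝔮, h𝔮, h𝔮ht, -, h𝔮I⟩ :=
      Literature.AlgebraicGeometry.Motives.exists_isPrime_height_eq_one_le_not_le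
        (maximalIdeal T) h2 hI
    haveI := h𝔮
    rw [Ideal.span_singleton_le_iff_mem] at h𝔮I
    have hf𝔮 : f ∉ 𝔮 := fun h => h𝔮I (𝔮.mul_mem_right _ h)
    have hϖ𝔮 : algebraMap 𝒪 T ϖ ∉ 𝔮 := fun h => h𝔮I (𝔮.mul_mem_left _ h)
    -- the quotient `T' = T/𝔮`
    haveI : Nontrivial (T ⧸ 𝔮) := Ideal.Quotient.nontrivial_iff.mpr h𝔮.ne_top
    haveI : IsLocalRing (T ⧸ 𝔮) :=
      IsLocalRing.of_surjective' (Ideal.Quotient.mk 𝔮) Ideal.Quotient.mk_surjective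
    haveI : IsAdicComplete (maximalIdeal (T ⧸ 𝔮)) (T ⧸ 𝔮) :=
      Literature.AlgebraicGeometry.Resolution.isAdicComplete_quotient 𝔮
    have hinj' : Function.Injective (algebraMap 𝒪 (T ⧸ 𝔮)) :=
      injective_algebraMap_quotient_of_notMem hϖ 𝔮 hϖ𝔮
    have hmk : (maximalIdeal T).map (Ideal.Quotient.mk 𝔮) = maximalIdeal (T ⧸ 𝔮) :=
      IsLocalRing.map_maximalIdeal_of_surjective _ Ideal.Quotient.mk_surjective
    have hloc' : (maximalIdeal 𝒪).map (algebraMap 𝒪 (T ⧸ 𝔮)) ≤ maximalIdeal (T ⧸ 𝔮) := by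
      rw [IsScalarTower.algebraMap_eq 𝒪 T (T ⧸ 𝔮), ← Ideal.map_map, Ideal.Quotient.algebraMap_eq,
        ← hmk]
      exact Ideal.map_mono hloc
    have hres' := surjective_residue_comp_algebraMap_quotient hres 𝔮
    -- the dimension drops
    have hdim' : (maximalIdeal (T ⧸ 𝔮)).height ≤ n := by
      have h𝔮0 : 𝔮 ≠ ⊥ := by
        intro h
        rw [h, Ideal.height_bot] at h𝔮ht
        exact zero_ne_one h𝔮ht
      obtain ⟨x, hx𝔮, hx0⟩ := Submodule.exists_mem_ne_zero_of_ne_bot h𝔮0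
      have hxle : Ideal.span {x} ≤ 𝔮 := (Ideal.span_singleton_le_iff_mem _).mpr hx𝔮
      have hd1 : ringKrullDim (T ⧸ 𝔮) ≤ ringKrullDim (T ⧸ Ideal.span {x}) :=
        ringKrullDim_le_of_surjective (Ideal.Quotient.factor hxle)
          (Ideal.Quotient.factor_surjective hxle)
      have hd2 : ringKrullDim (T ⧸ Ideal.span {x}) + 1 ≤ ringKrullDim T :=
        ringKrullDim_quotient_succ_le_of_nonZeroDivisor (mem_nonZeroDivisors_of_ne_zero hx0)
      have hd3 : ringKrullDim (T ⧸ 𝔮) + 1 ≤ ringKrullDim T := (add_le_add_left hd1 1).trans hd2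
      rw [← IsLocalRing.maximalIdeal_height_eq_ringKrullDim,
        ← IsLocalRing.maximalIdeal_height_eq_ringKrullDim] at hd3
      have hd4 : ((maximalIdeal (T ⧸ 𝔮)).height : WithBot ℕ∞) + 1 ≤ ((n + 1 : ℕ) : ℕ∞) :=
        hd3.trans (by exact_mod_cast hdim)
      have hd5 : (maximalIdeal (T ⧸ 𝔮)).height + 1 ≤ (n : ℕ∞) + 1 := by
        have : ((maximalIdeal (T ⧸ 𝔮)).height : WithBot ℕ∞) + 1 ≤ (((n : ℕ∞) + 1 : ℕ∞) : WithBot ℕ∞) := by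
          simpa using hd4
        exact_mod_cast this
      exact (WithTop.add_le_add_iff_right (WithTop.one_ne_top)).mp hd5
    -- recurse and compose with `T → T/𝔮`
    have hf' : Ideal.Quotient.mk 𝔮 f ≠ 0 := fun h => hf𝔮 (Ideal.Quotient.eq_zero_iff_mem.mp h)
    obtain ⟨ψ', hψ', hψ'n, hψ'f⟩ := ih (T ⧸ 𝔮) inferInstance hinj' hloc' hres' hdim' _ hf'
    refine ⟨ψ'.comp (Ideal.Quotient.mk 𝔮), ?_, fun x => hψ'n _, hψ'f⟩
    rw [RingHom.comp_assoc, ← Ideal.Quotient.algebraMap_eq, ← IsScalarTower.algebraMap_eq 𝒪 T (T ⧸ 𝔮)]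
    exact hψ'

/-! ### The density theorem -/

/-- **`𝒪_{ℚ̄_p}`-valued points are Zariski-dense in an `𝒪`-torsion-free complete Noetherian
local `𝒪`-algebra with the residue field of `𝒪`.**  If the non-zero elements of the complete
discrete valuation ring `𝒪 ↪ ℚ̄_p` act as non-zero-divisors on `T` and `f ∈ T` is not
nilpotent, there is an `𝒪`-algebra point `ψ : T → ℚ̄_p` with `‖ψ‖ ≤ 1` and `ψ(f) ≠ 0`: pass to
`T/𝔮` for a minimal prime `𝔮 ∌ f` (it misses the non-zero-divisors, in particular `𝒪 ∖ 0`)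
and apply the domain case.  Equivalently `⋂_ψ ker ψ = nilradical T`. [folklore] -/
theorem exists_ringHom_padicAlgCl_apply_ne_zero (hι : Function.Injective ι)
    (hιn : ∀ x, ‖ι x‖ ≤ 1) (T : Type u) [CommRing T] [IsLocalRing T] [IsNoetherianRing T]
    [IsAdicComplete (maximalIdeal T) T] [Algebra 𝒪 T]
    (htf : ∀ a : 𝒪, a ≠ 0 → algebraMap 𝒪 T a ∈ nonZeroDivisors T)
    (hloc : (maximalIdeal 𝒪).map (algebraMap 𝒪 T) ≤ maximalIdeal T)
    (hres : Function.Surjective ((residue T).comp (algebraMap 𝒪 T)))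
    {f : T} (hf : ¬ IsNilpotent f) :
    ∃ ψ : T →+* PadicAlgCl p, ψ.comp (algebraMap 𝒪 T) = ι ∧ (∀ x, ‖ψ x‖ ≤ 1) ∧ ψ f ≠ 0 := by
  -- a minimal prime missing `f`
  have hfnil : f ∉ (⊥ : Ideal T).radical := fun h => hf (mem_nilradical.mp h)
  have hex : ∃ 𝔮 ∈ (⊥ : Ideal T).minimalPrimes, f ∉ 𝔮 := by
    by_contra h
    push Not at h
    exact hfnil (Ideal.sInf_minimalPrimes (I := (⊥ : Ideal T)) ▸ Submodule.mem_sInf.mpr h)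
  obtain ⟨𝔮, h𝔮min, hf𝔮⟩ := hex
  haveI : 𝔮.IsPrime := h𝔮min.1.1
  obtain ⟨ϖ, hϖ⟩ := IsDiscreteValuationRing.exists_irreducible 𝒪
  have hϖ𝔮 : algebraMap 𝒪 T ϖ ∉ 𝔮 := fun h =>
    Set.disjoint_left.mp (Ideal.disjoint_nonZeroDivisors_of_mem_minimalPrimes h𝔮min) h
      (htf ϖ hϖ.ne_zero)
  -- the quotient `T/𝔮`: a complete local domain into which `𝒪` injects
  haveI : Nontrivial (T ⧸ 𝔮) := Ideal.Quotient.nontrivial_iff.mpr ‹𝔮.IsPrime›.ne_top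
  haveI : IsLocalRing (T ⧸ 𝔮) :=
    IsLocalRing.of_surjective' (Ideal.Quotient.mk 𝔮) Ideal.Quotient.mk_surjective
  haveI : IsAdicComplete (maximalIdeal (T ⧸ 𝔮)) (T ⧸ 𝔮) :=
    Literature.AlgebraicGeometry.Resolution.isAdicComplete_quotient 𝔮
  have hinj' : Function.Injective (algebraMap 𝒪 (T ⧸ 𝔮)) :=
    injective_algebraMap_quotient_of_notMem hϖ 𝔮 hϖ𝔮
  have hmk : (maximalIdeal T).map (Ideal.Quotient.mk 𝔮) = maximalIdeal (T ⧸ 𝔮) :=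
    IsLocalRing.map_maximalIdeal_of_surjective _ Ideal.Quotient.mk_surjective
  have hloc' : (maximalIdeal 𝒪).map (algebraMap 𝒪 (T ⧸ 𝔮)) ≤ maximalIdeal (T ⧸ 𝔮) := by
    rw [IsScalarTower.algebraMap_eq 𝒪 T (T ⧸ 𝔮), ← Ideal.map_map, Ideal.Quotient.algebraMap_eq,
      ← hmk]
    exact Ideal.map_mono hloc
  have hres' := surjective_residue_comp_algebraMap_quotient hres 𝔮
  have hf' : Ideal.Quotient.mk 𝔮 f ≠ 0 := fun h => hf𝔮 (Ideal.Quotient.eq_zero_iff_mem.mp h)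
  -- finite dimension
  have hfin : (maximalIdeal (T ⧸ 𝔮)).height ≠ ⊤ := Ideal.height_ne_top (maximalIdeal.isMaximal _).ne_top
  obtain ⟨n, hn⟩ := ENat.ne_top_iff_exists.mp hfin
  obtain ⟨ψ', hψ', hψ'n, hψ'f⟩ :=
    exists_ringHom_padicAlgCl_apply_ne_zero_of_isDomain ι hι hιn n (T ⧸ 𝔮) inferInstance hinj'
      hloc' hres' (le_of_eq hn.symm) _ hf'
  refine ⟨ψ'.comp (Ideal.Quotient.mk 𝔮), ?_, fun x => hψ'n _, hψ'f⟩
  rw [RingHom.comp_assoc, ← Ideal.Quotient.algebraMap_eq, ← IsScalarTower.algebraMap_eq 𝒪 T (T ⧸ 𝔮)]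
  exact hψ'


/-- **Zariski density, separation form.**  Under the hypotheses of
`exists_ringHom_padicAlgCl_apply_ne_zero` and with `T` REDUCED, an element of `T` killed by every
`𝒪`-algebra point `T → ℚ̄_p` of norm `≤ 1` is zero (`⋂_ψ ker ψ = 0`). [folklore] -/
theorem eq_zero_of_forall_ringHom_padicAlgCl_apply_eq_zero (hι : Function.Injective ι)
    (hιn : ∀ x, ‖ι x‖ ≤ 1) (T : Type u) [CommRing T] [IsLocalRing T] [IsNoetherianRing T]
    [IsAdicComplete (maximalIdeal T) T] [IsReduced T] [Algebra 𝒪 T]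
    (htf : ∀ a : 𝒪, a ≠ 0 → algebraMap 𝒪 T a ∈ nonZeroDivisors T)
    (hloc : (maximalIdeal 𝒪).map (algebraMap 𝒪 T) ≤ maximalIdeal T)
    (hres : Function.Surjective ((residue T).comp (algebraMap 𝒪 T))) (x : T)
    (hx : ∀ ψ : T →+* PadicAlgCl p, ψ.comp (algebraMap 𝒪 T) = ι → (∀ y, ‖ψ y‖ ≤ 1) → ψ x = 0) :
    x = 0 := by
  by_contra hne
  have hnil : ¬ IsNilpotent x := fun h => hne h.eq_zero
  obtain ⟨ψ, hψ, hψn, hψx⟩ := exists_ringHom_padicAlgCl_apply_ne_zero ι hι hιn T htf hloc hres hnil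
  exact hψx (hx ψ hψ hψn)

end Literature.NumberTheory.GaloisRepresentations

end
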